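import Literature.IUT.HodgeTheaters.Cor53iiiTelescopeKnit
import Literature.IUT.HodgeTheaters.Cor53iArithHratOfMonoidRigidity
import Literature.IUT.HodgeTheaters.Cor53iLiftsAllAtArithmeticGlobalModel
import Literature.IUT.HodgeTheaters.Cor53iFcircHkerTransport
import Literature.IUT.HodgeTheaters.Cor53iLiftsAllAtFcirc
import HarnessLib

/-!
# Layer-5 certificate v0.22 — BLOCK F over BUILT Literature modules only: [IUTchI] Cor 5.3 (iii) THREE-SLOT surjectivity and Cor 5.3 (i)
# «bijective» at `ℱ^⊛` / `ℱ^⊚` with the surjectivity half DISCHARGED modulo Neukirch–Uchida (abc-iut-L5-lead gen 9 ask of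
# 2026-08-27T12:44:36Z (2) «V22 CONTENT PREP»; standby CERT writer abc-iut-L5-t9 gen 8, row R73; LAYER5-CERT-SPEC.md §7)

PROOF-ONLY (no `def`, no `instance`, no `axiom`, no `sorry`, no `notation`); NO `Conditional` import (architecture-neutral: the same three
conjuncts serve a chained top `Layer5OfSV22` = `StatementOf v21 ∧ …` or a FLAT top over built modules, R62 precedent).  Every theorem is a
landed Literature theorem VERBATIM (section variables spelled in), proof BY NAME — one-call compositions only:
* (C-53iii) `layer5_disch_cor53iii_v22_threeSlot` := abc-iut-L5-t4's `Cor53iii.threeSlot_dashLiftsAll` (★ p526558) — at EVERY index of the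
  genuine `ℱ`-kit of record (good nonarchimedean · bad · archimedean) «the natural map `Isom(¹𝔉⊢, ²𝔉⊢) → Isom(¹𝔇⊢, ²𝔇⊢)` is surjective»,
  under the kit's binders {`D`, `CG`, `hA`, `B`, `I`} ONLY: LAW ∅ · FACT ∅ · side ∅ (GOOD ★ p520897/★ p521802 · BAD ★ p523255 · ARCH ★ p525809,
  each BY NAME inside the knit).  NOT claimed: injectivity at any slot; the archimedean dilation lift (row R84 ★ p528369) and the O1 one-call
  (★ p530609) are optional riders, not displayed here.
* (C-53i⊛) `layer5_disch_cor53i_v22_arith` := `Cor53.arith_descendBijective_of_ratioRigid_of_lifts` (★ p525667) with its `hlift` binder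
  DISCHARGED by `GlobalDivisorData.liftsAll_modelBase_arith_of_neukirchUchida` (★ p525660): [IUTchI] Cor 5.3 (i) AS PRINTED («bijective»)
  at the genuine arithmetic model `ℱ^⊛(†𝒟^⊚) → ℬ(G_F)⁰`.  DISPLAYED binders exactly {`hB` = 𝔹-RATIO⊛ (print's Ex 5.1 (v) unit-ratio law;
  FACT-SHAPE ≙ F-2577 `UniqueCyclotomeIsoFamily`), `hNU : NeukirchUchida F` (FACT)}; [FrdI] Cor 4.11 (iv) and Φ-rigidity of principal
  divisors are PROVED inside ★ p525667.
* (C-53i⊚) `layer5_disch_cor53i_v22_fcirc` := `Cor53.fcirc_descendBijective_of_ratioRigid_of_lifts` (★ p530688) with its `hlift` binder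
  DISCHARGED by `GlobalFrobenioid.liftsAll_fcircBase_arith_of_desc_of_neukirchUchida` (★ p527866): Cor 5.3 (i) «respectively `⊚`» AS
  PRINTED at the record carrier `†ℱ^⊚ → †𝒟^⊚ = ℬ(H)⁰` for ANY isomorph `†ℱ^⊛` of `ℱ^⊛(†𝒟^⊚)` over `ℬ(H)⁰`.  DISPLAYED binders exactly
  {`hB` = 𝔹-RATIO⊚ for the RESTRICTED arithmetic data (FACT-SHAPE ≙ F-2577), `hdesc` = descent of `Aut(†𝒟^⊚)` to `Base(†ℱ^⊛)` (FACT-SHAPE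
  ≙ F-0399), `hNU : NeukirchUchida F` (FACT), `hZ : IsSlimGroup H` (side)}.
CENSUS delta for §7 (abc-iut-L5-lead's booking): CONE +2 (Cor5.3(iii), Cor5.3(i)) · FACT +1 (Neukirch–Uchida, counted once) · display +3.
S. Mochizuki, *Inter-universal Teichmüller theory I* [cite: Mochizuki2012] (D-0012 claim key; series status DISPUTED): Cor 5.3 (i), (iii)
p. 144; Ex 5.1 (v) p. 128.  HONEST FRAMING: a CERT conjunct DISPLAYS its binders, it does not discharge them; `NeukirchUchida F` is a
published theorem carried BY NAME as a `Prop`, not proved here; the FACT-SHAPE binders are hypotheses whose dischargers are not in the tree;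
nothing here asserts that abc is proved or refuted or takes a side on [IUTchIII] Cor. 3.12; typed ≠ inhabited ≠ discharged; indexed ≠ endorsed.
-/

namespace Summit.ABC.IUTFork.Conditional

open CategoryTheory Opposite Literature.IUT.HodgeTheaters
open Literature.AnabelianGeometry.SemiGraphs Literature.AlgebraicGeometry.Frobenioids
open Literature.AnabelianGeometry.AbsoluteAnabelian Literature.NumberTheory.GaloisRepresentations
open Literature.IUT.HodgeTheaters.Cor53iii (ArchDashTriple ArchDashTriple.Iso)
open scoped ValuativeRel

noncomputable section BlocksFV22

/-- **(C-53iii) [IUTchI] Cor 5.3 (iii) — THREE-SLOT KNIT at the genuine `ℱ`-kit of record** (★ p526558 `Cor53iii.threeSlot_dashLiftsAll`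
VERBATIM, the `AtTerm` binders {`D`, `CG`, `hA`, `B`, `I`} spelled in): «the natural map `Isom(¹𝔉⊢, ²𝔉⊢) → Isom(¹𝔇⊢, ²𝔇⊢)` is surjective»,
read index by index — (GOOD) every self-equivalence of `𝒟⊢_v̲` lifts to a `τ⊢`-preserving self-equivalence of `(D.frobeniusGoodAt …).Cdash`
lying under it; (BAD) the same for `(D.frobeniusBadAt …).Cdash → (…).Ddash`; (ARCH) the slot is inhabited and every `𝕋𝕄⊢`-isomorphism of
`𝒟⊢`-constituents extends to an isomorphism of triples.  LAW ∅ · FACT ∅ · side ∅.  NOT claimed: injectivity at any slot; the archimedean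
dilation lift (R84). [cite: Mochizuki2012, IUTchI Cor 5.3 (iii) p.144] [claim: Mochizuki2012, status: disputed] -/
theorem layer5_disch_cor53iii_v22_threeSlot
    {F K Fbar : Type} [Field F] [NumberField F] [Field K] [NumberField K] [Algebra F K]
    [Field Fbar] [Algebra F Fbar] [Algebra K Fbar] {E : WeierstrassCurve F} [E.IsElliptic] {l : ℕ} {Pb : BadPlacePredicates K}
    (D : InitialThetaData F K Fbar E l Pb) (CG : D.geom.pe.CuspGalois) (hA : D.geom.pe.ArrowCoveringClaims)
    (B : ∀ v, v ∈ D.indexCopyBad → D.BadPairAt v) (I : D.MergeInputs B) :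
    (∀ (x : D.IndexCopy) (hx : x ∉ D.indexCopyArc) [Fact (D.primeAt x hx).Prime]
        (E : CosetCat (AlgebraicClosure (D.KvAt x hx) ≃ₐ[D.KvAt x hx] AlgebraicClosure (D.KvAt x hx)) ≌
          CosetCat (AlgebraicClosure (D.KvAt x hx) ≃ₐ[D.KvAt x hx] AlgebraicClosure (D.KvAt x hx))),
        letI := GaloisValDatum.normVal (D.KvAt x hx)
        ∃ Ψ : (D.frobeniusGoodAt CG hA B I x hx).Cdash ≌ (D.frobeniusGoodAt CG hA B I x hx).Cdash,
          Nonempty (CatIsomorphism.LiesUnder (D.frobeniusGoodAt CG hA B I x hx).CdashBase (D.frobeniusGoodAt CG hA B I x hx).CdashBase Ψ E) ∧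
          (D.frobeniusGoodAt CG hA B I x hx).tauDash.IsPreservedBy (D.frobeniusGoodAt CG hA B I x hx).tauDash Ψ.functor) ∧
    (∀ (x : D.IndexCopy) (hx : x ∈ D.indexCopyBad) (E : (D.frobeniusBadAt B I x hx).Ddash ≌ (D.frobeniusBadAt B I x hx).Ddash),
        ∃ Ψ : (D.frobeniusBadAt B I x hx).Cdash ≌ (D.frobeniusBadAt B I x hx).Cdash,
          Nonempty (CatIsomorphism.LiesUnder (D.frobeniusBadAt B I x hx).CdashBase (D.frobeniusBadAt B I x hx).CdashBase Ψ E) ∧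
          (D.frobeniusBadAt B I x hx).tauDash.IsPreservedBy (D.frobeniusBadAt B I x hx).tauDash Ψ.functor) ∧
    (∀ (x : D.IndexCopy) (hx : x ∈ D.indexCopyArc),
        Nonempty (ArchDashTriple (D.frobeniusArcAt x hx).Cv (D.frobeniusArcAt x hx).OC) ∧
        ∀ (T₁ T₂ : ArchDashTriple (D.frobeniusArcAt x hx).Cv (D.frobeniusArcAt x hx).OC) (g : SplitTopMonoid.Hom T₁.M T₂.M),
          ∃ f : ArchDashTriple.Iso T₁ T₂, f.toDash = g) :=
  Cor53iii.threeSlot_dashLiftsAll D CG hA B I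

/-- **(C-53i⊛) [IUTchI] Cor 5.3 (i) AS PRINTED («bijective») at the genuine arithmetic model `ℱ^⊛(†𝒟^⊚) → ℬ(G_F)⁰`** :=
★ p525667 `Cor53.arith_descendBijective_of_ratioRigid_of_lifts` with `hlift` DISCHARGED by ★ p525660
`GlobalDivisorData.liftsAll_modelBase_arith_of_neukirchUchida`.  DISPLAYED binders exactly: `hB` = 𝔹-RATIO⊛ (Ex 5.1 (v) unit-ratio law for
self-equivalences over the identity; FACT-SHAPE ≙ F-2577) · `hNU : NeukirchUchida F` (FACT, BY NAME).  Injectivity alone is `(this …).1`.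
[cite: Mochizuki2012, IUTchI Cor 5.3 (i) p.144] [claim: Mochizuki2012, status: disputed] -/
theorem layer5_disch_cor53i_v22_arith (F : Type) [Field F] [NumberField F]
    (hB : ∀ Ψ : (GlobalDivisorData.arith F).ModelGlobalFrobenioid ≌ (GlobalDivisorData.arith F).ModelGlobalFrobenioid,
      Nonempty (Ψ.functor ⋙ (GlobalDivisorData.arith F).modelBase ≅ (GlobalDivisorData.arith F).modelBase) →
      ∃ η : Ψ.functor ⋙ (GlobalDivisorData.arith F).modelBase ≅ (GlobalDivisorData.arith F).modelBase,
        ∀ ⦃X Y : (GlobalDivisorData.arith F).ModelGlobalFrobenioid⦄ (f g : X ⟶ Y), ModelFrobenioid.degFr f = 1 →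
          ModelFrobenioid.degFr g = 1 → ModelFrobenioid.baseMap f = ModelFrobenioid.baseMap g →
            ModelFrobenioid.unit (Ψ.functor.map f) *
                pull (GlobalDivisorData.arith F).B (A := X.base) (B := (Ψ.functor.obj X).base) (η.hom.app X)
                  (ModelFrobenioid.unit g) =
              ModelFrobenioid.unit (Ψ.functor.map g) *
                pull (GlobalDivisorData.arith F).B (A := X.base) (B := (Ψ.functor.obj X).base) (η.hom.app X)
                  (ModelFrobenioid.unit f))
    (hNU : NeukirchUchida F) :
    CatIsomorphism.DescendBijective (GlobalDivisorData.arith F).modelBase (GlobalDivisorData.arith F).modelBase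
      (GlobalDivisorData.hasUnder_modelBase_arith F F) (GlobalDivisorData.underUnique_modelBase_arith F F) :=
  Cor53.arith_descendBijective_of_ratioRigid_of_lifts F hB
    (GlobalDivisorData.liftsAll_modelBase_arith_of_neukirchUchida F hNU)

/-- **(C-53i⊚) [IUTchI] Cor 5.3 (i) «respectively `⊚`» AS PRINTED («bijective») at the record carrier `†ℱ^⊚ → †𝒟^⊚ = ℬ(H)⁰`**, for
ANY isomorph `𝓕 : GlobalFrobenioid (GlobalDivisorData.arith F) (BaseCat H) toBase0` of `ℱ^⊛(†𝒟^⊚)` over `ℬ(H)⁰` := ★ p530688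
`Cor53.fcirc_descendBijective_of_ratioRigid_of_lifts` with `hlift` DISCHARGED by ★ p527866
`GlobalFrobenioid.liftsAll_fcircBase_arith_of_desc_of_neukirchUchida`.  DISPLAYED binders exactly: `hZ : IsSlimGroup H` (side) · `hB` =
𝔹-RATIO⊚ for the RESTRICTED arithmetic data `(Φ^⊛ ∘ T, 𝔹^⊛ ∘ T, Div ∘ T)`, `T := baseMor ⋙ identify` (FACT-SHAPE ≙ F-2577) · `hdesc` = every
self-equivalence of `†𝒟^⊚` descends to `Base(†ℱ^⊛)` along `baseMor` (FACT-SHAPE ≙ F-0399) · `hNU : NeukirchUchida F` (FACT, BY NAME).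
[cite: Mochizuki2012, IUTchI Cor 5.3 (i) p.144] [claim: Mochizuki2012, status: disputed] -/
theorem layer5_disch_cor53i_v22_fcirc
    {F : Type} [Field F] [NumberField F] {H : ProfiniteGrp.{0}} {toBase0 : BaseCat H ⥤ BaseCat (absGalGrp F)}
    (𝓕 : GlobalFrobenioid (GlobalDivisorData.arith F) (BaseCat H) toBase0) (hZ : IsSlimGroup H)
    (hB : ∀ Ψ : (GlobalDivisorData.mk ((𝓕.baseMor ⋙ 𝓕.identify.functor).op ⋙ (GlobalDivisorData.arith F).Φ)
        ((𝓕.baseMor ⋙ 𝓕.identify.functor).op ⋙ (GlobalDivisorData.arith F).B)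
        (Functor.whiskerLeft (𝓕.baseMor ⋙ 𝓕.identify.functor).op (GlobalDivisorData.arith F).div) : GlobalDivisorData H).ModelGlobalFrobenioid ≌
        (GlobalDivisorData.mk ((𝓕.baseMor ⋙ 𝓕.identify.functor).op ⋙ (GlobalDivisorData.arith F).Φ)
        ((𝓕.baseMor ⋙ 𝓕.identify.functor).op ⋙ (GlobalDivisorData.arith F).B)
        (Functor.whiskerLeft (𝓕.baseMor ⋙ 𝓕.identify.functor).op (GlobalDivisorData.arith F).div) : GlobalDivisorData H).ModelGlobalFrobenioid,
      Nonempty (Ψ.functor ⋙ (GlobalDivisorData.mk ((𝓕.baseMor ⋙ 𝓕.identify.functor).op ⋙ (GlobalDivisorData.arith F).Φ)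
        ((𝓕.baseMor ⋙ 𝓕.identify.functor).op ⋙ (GlobalDivisorData.arith F).B)
        (Functor.whiskerLeft (𝓕.baseMor ⋙ 𝓕.identify.functor).op (GlobalDivisorData.arith F).div) : GlobalDivisorData H).modelBase ≅
        (GlobalDivisorData.mk ((𝓕.baseMor ⋙ 𝓕.identify.functor).op ⋙ (GlobalDivisorData.arith F).Φ)
        ((𝓕.baseMor ⋙ 𝓕.identify.functor).op ⋙ (GlobalDivisorData.arith F).B)
        (Functor.whiskerLeft (𝓕.baseMor ⋙ 𝓕.identify.functor).op (GlobalDivisorData.arith F).div) : GlobalDivisorData H).modelBase) →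
      ∃ η : Ψ.functor ⋙ (GlobalDivisorData.mk ((𝓕.baseMor ⋙ 𝓕.identify.functor).op ⋙ (GlobalDivisorData.arith F).Φ)
        ((𝓕.baseMor ⋙ 𝓕.identify.functor).op ⋙ (GlobalDivisorData.arith F).B)
        (Functor.whiskerLeft (𝓕.baseMor ⋙ 𝓕.identify.functor).op (GlobalDivisorData.arith F).div) : GlobalDivisorData H).modelBase ≅
        (GlobalDivisorData.mk ((𝓕.baseMor ⋙ 𝓕.identify.functor).op ⋙ (GlobalDivisorData.arith F).Φ)
        ((𝓕.baseMor ⋙ 𝓕.identify.functor).op ⋙ (GlobalDivisorData.arith F).B)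
        (Functor.whiskerLeft (𝓕.baseMor ⋙ 𝓕.identify.functor).op (GlobalDivisorData.arith F).div) : GlobalDivisorData H).modelBase,
        ∀ ⦃X Y : (GlobalDivisorData.mk ((𝓕.baseMor ⋙ 𝓕.identify.functor).op ⋙ (GlobalDivisorData.arith F).Φ)
        ((𝓕.baseMor ⋙ 𝓕.identify.functor).op ⋙ (GlobalDivisorData.arith F).B)
        (Functor.whiskerLeft (𝓕.baseMor ⋙ 𝓕.identify.functor).op (GlobalDivisorData.arith F).div) : GlobalDivisorData H).ModelGlobalFrobenioid⦄ (f g : X ⟶ Y),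
          ModelFrobenioid.degFr f = 1 → ModelFrobenioid.degFr g = 1 → ModelFrobenioid.baseMap f = ModelFrobenioid.baseMap g →
            ModelFrobenioid.unit (Ψ.functor.map f) *
                pull (GlobalDivisorData.mk ((𝓕.baseMor ⋙ 𝓕.identify.functor).op ⋙ (GlobalDivisorData.arith F).Φ)
        ((𝓕.baseMor ⋙ 𝓕.identify.functor).op ⋙ (GlobalDivisorData.arith F).B)
        (Functor.whiskerLeft (𝓕.baseMor ⋙ 𝓕.identify.functor).op (GlobalDivisorData.arith F).div) : GlobalDivisorData H).B (A := X.base) (B := (Ψ.functor.obj X).base) (η.hom.app X)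
                  (ModelFrobenioid.unit g) =
              ModelFrobenioid.unit (Ψ.functor.map g) *
                pull (GlobalDivisorData.mk ((𝓕.baseMor ⋙ 𝓕.identify.functor).op ⋙ (GlobalDivisorData.arith F).Φ)
        ((𝓕.baseMor ⋙ 𝓕.identify.functor).op ⋙ (GlobalDivisorData.arith F).B)
        (Functor.whiskerLeft (𝓕.baseMor ⋙ 𝓕.identify.functor).op (GlobalDivisorData.arith F).div) : GlobalDivisorData H).B (A := X.base) (B := (Ψ.functor.obj X).base) (η.hom.app X)
                  (ModelFrobenioid.unit f))
    (hdesc : ∀ Θ : BaseCat H ≌ BaseCat H, ∃ ΘB : 𝓕.Base ≌ 𝓕.Base,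
      Nonempty (Θ.functor ⋙ 𝓕.baseMor ≅ 𝓕.baseMor ⋙ ΘB.functor))
    (hNU : NeukirchUchida F) :
    CatIsomorphism.DescendBijective 𝓕.fcircBase 𝓕.fcircBase
      (GlobalFrobenioid.hasUnder_and_underUnique_fcircBase_arith_baseCat 𝓕 𝓕 hZ hZ).1
      (GlobalFrobenioid.hasUnder_and_underUnique_fcircBase_arith_baseCat 𝓕 𝓕 hZ hZ).2 :=
  Cor53.fcirc_descendBijective_of_ratioRigid_of_lifts 𝓕 hZ hB
    (𝓕.liftsAll_fcircBase_arith_of_desc_of_neukirchUchida hdesc hNU)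

end BlocksFV22

end Summit.ABC.IUTFork.Conditional

/-! ### Build-lane export guard (ops-buildfix bf1-g30, 2026-08-28; G11b-3 recipe v2 as in `GelbartRogawski1991/UnitaryDualPairSeesawCharacter`):
the theorems of this file carry very large dependent telescopes; at `.olean` export Lean 4.32's library-suggestion indexers fold over
every local theorem statement and do not finish within the build lane's one-hour clock (measured on a farm node: `lean -o` > 1 500 s, plain
elaboration ≈ 20 s). ONE file-final `local` `[implicit_reducible]` keeps them out of that premise index (inert for Meta and the kernel on
theorems; no definition is tagged; statements and proofs unchanged). -/
set_option allowUnsafeReducibility true in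
attribute [local implicit_reducible]
  _root_.Summit.ABC.IUTFork.Conditional.layer5_disch_cor53iii_v22_threeSlot
  _root_.Summit.ABC.IUTFork.Conditional.layer5_disch_cor53i_v22_arith
  _root_.Summit.ABC.IUTFork.Conditional.layer5_disch_cor53i_v22_fcirc
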